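import Literature.Claims.NS.Wu2026
import Mathlib.MeasureTheory.Measure.Haar.NormedSpace
import Mathlib.MeasureTheory.Measure.Lebesgue.EqHaar
import HarnessLib

/-!
# C177 `Wu2026` — SALVAGE, TRUE column: the exact blow-down scaling of the physical current
# (3.83) (D-0090 NS-CLAIMS, LADDER row rung 3; salvage seat `ns-claims-salvage-p3`)

First helper toward the binder `Literature.Claims.NS.Wu2026.Step_385` ((3.83)–(3.85), p.25–26) of
`claim_of_steps''` (skeleton p558978/p560520, typist-10 g6). The print (p.25 l.146 – p.26 l.5)
rescales the right-hand side of the harmonic cut-off identity (3.82) at `R = R_j` by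
`x = R_j y`: with `V_R(y) = R^{2/3} v(Ry)`, `P_R(y) = R^{4/3} q(Ry)`, `Q_R = P_R + |V_R|²/2 = R^{4/3}𝒬(Ry)`
one has `Q_R V_R = R² (𝒬 v)(Ry)`, `y/|y|³ = R² · (Ry)/|Ry|³`, `dy = R⁻³ dx`, hence
`−R ∫_{|x|>R} 𝒬 v·x/|x|³ dx = −∫_{|y|>1} Q_R V_R·y/|y|³ dy` EXACTLY (no limit involved). This file
proves that identity for the skeleton's `current382`, `blowDown`, `blowDownP`, `bern`, `exterior`
(`current382_eq_blowDown`), together with the `ℝ≥0∞` change of variables for the absolute tails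
`∫_{|y|>L} |Q_R V_R| |y|⁻² dy = R ∫_{|x|>RL} |𝒬 v| |x|⁻² dx` (`lintegral_tail_blowDown`) used for the
uniform Abel tail (3.78). Tools: Mathlib `Measure.setIntegral_comp_smul_of_pos`,
`Measure.map_addHaar_smul` + `lintegral_map_equiv` (finrank `ℝ³ = 3`).

Theorems only, standard axioms, no `sorry`.

WHAT THIS IS NOT: not a claim about NS regularity or blow-up; not a claim about any author beyond the
typed locator.
-/

set_option linter.dupNamespace false

noncomputable section

open MeasureTheory Set Filter Topology Module Metric
open scoped ENNReal NNReal Topology RealInnerProductSpace Pointwise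

namespace Summit.NavierStokesRegularity.NavierStokesRegularity.Theorems.Wu2026Salvage

open Literature.Analysis.FluidPDE Literature.Analysis.FunctionSpaces Literature.Claims.NS.Wu2026

/-! ## Pointwise scaling of the rescaled fields -/

/-- `‖R • y‖ = R‖y‖` for `R > 0`. [folklore] -/
theorem norm_smul_of_pos {R : ℝ} (hR : 0 < R) (y : E3) : ‖R • y‖ = R * ‖y‖ := by
  rw [norm_smul, Real.norm_of_nonneg hR.le]

/-- The Bernoulli function of the blow-down pair: `Q_R(y) = R^{4/3} 𝒬(Ry)` (p.24 l.37–39 «Here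
`Q_j(y) = R_j^{4/3} 𝒬(R_j y)` by (3.38)»). [cite: Wu2026, (3.38) p.14, p.24 l.37–39] -/
theorem bern_blowDown {R : ℝ} (hR : 0 < R) (v : E3 → E3) (q : E3 → ℝ) (y : E3) :
    bern (blowDown R v) (blowDownP R q) y = R ^ ((4 : ℝ) / 3) * bern v q (R • y) := by
  unfold bern blowDown blowDownP
  have h1 : ‖R ^ ((2 : ℝ) / 3) • v (R • y)‖ ^ 2 = R ^ ((4 : ℝ) / 3) * ‖v (R • y)‖ ^ 2 := by
    rw [norm_smul, Real.norm_of_nonneg (Real.rpow_nonneg hR.le _), mul_pow, ← Real.rpow_natCast,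
      ← Real.rpow_mul hR.le]
    norm_num
  rw [h1]
  ring

/-- The velocity pairing of the blow-down: `⟪V_R(y), y⟫ = R^{2/3}⟪v(Ry), y⟫`. [cite: Wu2026, (3.19) p.10] -/
theorem inner_blowDown (R : ℝ) (v : E3 → E3) (y : E3) :
    ⟪blowDown R v y, y⟫ = R ^ ((2 : ℝ) / 3) * ⟪v (R • y), y⟫ := by
  unfold blowDown
  rw [real_inner_smul_left]

/-- The current integrand of the blow-down pair is `R⁴` times the physical current integrand at
`x = Ry`: `Q_R V_R·y/|y|³ = R⁴ · (𝒬 v·x/|x|³)|_{x = Ry}` (p.25 l.146 – p.26 l.5). [cite: Wu2026, (3.83) p.25 l.146 – p.26 l.5] -/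
theorem current_integrand_blowDown {R : ℝ} (hR : 0 < R) (v : E3 → E3) (q : E3 → ℝ) (y : E3) :
    bern (blowDown R v) (blowDownP R q) y * ⟪blowDown R v y, y⟫ / ‖y‖ ^ 3 =
      R ^ 4 * (bern v q (R • y) * ⟪v (R • y), R • y⟫ / ‖R • y‖ ^ 3) := by
  rw [bern_blowDown hR, inner_blowDown, real_inner_smul_right, norm_smul_of_pos hR]
  by_cases hy : y = 0
  · subst hy
    simp
  have hy0 : 0 < ‖y‖ := norm_pos_iff.2 hy
  have h43 : R ^ ((4 : ℝ) / 3) * R ^ ((2 : ℝ) / 3) = R ^ 2 := by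
    rw [← Real.rpow_add hR, ← Real.rpow_natCast]
    norm_num
  set B : ℝ := bern v q (R • y)
  set I : ℝ := ⟪v (R • y), y⟫
  calc R ^ ((4 : ℝ) / 3) * B * (R ^ ((2 : ℝ) / 3) * I) / ‖y‖ ^ 3
      = (R ^ ((4 : ℝ) / 3) * R ^ ((2 : ℝ) / 3)) * (B * I) / ‖y‖ ^ 3 := by ring
    _ = R ^ 2 * (B * I) / ‖y‖ ^ 3 := by rw [h43]
    _ = R ^ 4 * (B * (R * I) / (R * ‖y‖) ^ 3) := by
        rw [mul_pow]
        field_simp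

/-- Absolute size of the rescaled current against the physical one:
`|Q_R(y)| |V_R(y)| |y|⁻² = R⁴ · (|𝒬| |v| |·|⁻²)(Ry)`, `y ≠ 0`. [cite: Wu2026, (3.77) p.24] -/
theorem abs_bern_mul_norm_blowDown {R : ℝ} (hR : 0 < R) (v : E3 → E3) (q : E3 → ℝ) (y : E3) :
    |bern (blowDown R v) (blowDownP R q) y| * ‖blowDown R v y‖ * ‖y‖ ^ (-(2 : ℝ)) =
      R ^ 4 * (|bern v q (R • y)| * ‖v (R • y)‖ * ‖R • y‖ ^ (-(2 : ℝ))) := by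
  rw [bern_blowDown hR, abs_mul, abs_of_pos (Real.rpow_pos_of_pos hR _)]
  unfold blowDown
  rw [norm_smul, Real.norm_of_nonneg (Real.rpow_nonneg hR.le _), norm_smul_of_pos hR,
    Real.mul_rpow hR.le (norm_nonneg _)]
  have h2 : R ^ ((4 : ℝ) / 3) * R ^ ((2 : ℝ) / 3) = R ^ 4 * R ^ (-(2 : ℝ)) := by
    rw [← Real.rpow_add hR, ← Real.rpow_natCast, ← Real.rpow_add hR]
    norm_num
  set B : ℝ := |bern v q (R • y)|
  set W : ℝ := ‖v (R • y)‖
  set N : ℝ := ‖y‖ ^ (-(2 : ℝ))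
  calc R ^ ((4 : ℝ) / 3) * B * (R ^ ((2 : ℝ) / 3) * W) * N
      = (R ^ ((4 : ℝ) / 3) * R ^ ((2 : ℝ) / 3)) * (B * W * N) := by ring
    _ = (R ^ 4 * R ^ (-(2 : ℝ))) * (B * W * N) := by rw [h2]
    _ = R ^ 4 * (B * W * (R ^ (-(2 : ℝ)) * N)) := by ring

/-! ## The dilated exterior region -/

/-- `R • {y | L < |y|} = {x | RL < |x|}` for `R > 0`. [folklore] -/
theorem smul_setOf_lt_norm {R : ℝ} (hR : 0 < R) (L : ℝ) :
    R • {y : E3 | L < ‖y‖} = {x : E3 | R * L < ‖x‖} := by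
  ext x
  rw [Set.mem_smul_set_iff_inv_smul_mem₀ hR.ne', mem_setOf_eq, mem_setOf_eq, norm_smul, norm_inv,
    Real.norm_of_nonneg hR.le, inv_mul_eq_div, lt_div_iff₀ hR, mul_comm]

/-- `R • {|y| > 1} = {|x| > R}` for `R > 0` (the substitution `x = Ry` of p.25 l.146). [cite: Wu2026, (3.83) p.25 l.146] -/
theorem smul_exterior {R : ℝ} (hR : 0 < R) : R • exterior = {x : E3 | R < ‖x‖} := by
  rw [show exterior = {y : E3 | (1 : ℝ) < ‖y‖} from rfl, smul_setOf_lt_norm hR, mul_one]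

/-! ## (3.83): the physical current equals the rescaled current, exactly -/

/-- **Exact blow-down scaling of the physical current** (p.25 l.127 – p.26 l.5, the passage from
(3.82) at `R = R_j` to (3.83)): for `R > 0`,
`−R∫_{|x|>R} 𝒬 v·x/|x|³ dx = −∫_{|y|>1} Q_R(y) V_R(y)·y/|y|³ dy`, `V_R = R^{2/3}v(R·)`,
`P_R = R^{4/3}q(R·)`, `Q_R = P_R + |V_R|²/2`. [cite: Wu2026, (3.83) p.25 l.127 – p.26 l.5] -/
theorem current382_eq_blowDown {R : ℝ} (hR : 0 < R) (v : E3 → E3) (q : E3 → ℝ) :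
    current382 R v q =
      -∫ y in exterior, bern (blowDown R v) (blowDownP R q) y * ⟪blowDown R v y, y⟫ / ‖y‖ ^ 3 := by
  have hfun : (fun y : E3 => bern (blowDown R v) (blowDownP R q) y * ⟪blowDown R v y, y⟫ / ‖y‖ ^ 3) =
      fun y => R ^ 4 * (fun x => bern v q x * ⟪v x, x⟫ / ‖x‖ ^ 3) (R • y) := by
    funext y
    exact current_integrand_blowDown hR v q y
  rw [hfun, integral_const_mul, Measure.setIntegral_comp_smul_of_pos (volume : Measure E3)
    (fun x => bern v q x * ⟪v x, x⟫ / ‖x‖ ^ 3) exterior hR,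
    smul_exterior hR, finrank_euclideanSpace, Fintype.card_fin, smul_eq_mul]
  unfold current382
  have hR3 : R ^ 4 * (R ^ 3)⁻¹ = R := by field_simp
  rw [← mul_assoc, hR3]

/-! ## `ℝ≥0∞` change of variables for the tails -/

/-- `∫⁻ F(Ry) dy = R⁻³ ∫⁻ F(x) dx` on `ℝ³`, `R > 0` (any `F : ℝ³ → ℝ≥0∞`). [folklore] -/
theorem lintegral_comp_smul_E3 {R : ℝ} (hR : 0 < R) (F : E3 → ℝ≥0∞) :
    ∫⁻ y, F (R • y) = ENNReal.ofReal ((R ^ 3)⁻¹) * ∫⁻ x, F x := by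
  have hmap := Measure.map_addHaar_smul (volume : Measure E3) hR.ne'
  rw [finrank_euclideanSpace, Fintype.card_fin, abs_of_pos (inv_pos.2 (pow_pos hR 3))] at hmap
  have hmeas : Measurable fun y : E3 => R • y := measurable_const_smul R
  calc ∫⁻ y, F (R • y) = ∫⁻ y, F ((MeasurableEquiv.smul₀ R hR.ne') y) := rfl
    _ = ∫⁻ x, F x ∂(Measure.map (MeasurableEquiv.smul₀ R hR.ne') volume) :=
        (lintegral_map_equiv F _).symm
    _ = ∫⁻ x, F x ∂(Measure.map (fun y : E3 => R • y) volume) := rfl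
    _ = ENNReal.ofReal ((R ^ 3)⁻¹) * ∫⁻ x, F x := by rw [hmap, lintegral_smul_measure, smul_eq_mul]

/-- Set version on exterior regions: `∫⁻_{|y|>L} F(Ry) dy = R⁻³ ∫⁻_{|x|>RL} F(x) dx`, `R > 0`. [folklore] -/
theorem setLIntegral_exterior_comp_smul {R : ℝ} (hR : 0 < R) (L : ℝ) (F : E3 → ℝ≥0∞) :
    ∫⁻ y in {y : E3 | L < ‖y‖}, F (R • y) =
      ENNReal.ofReal ((R ^ 3)⁻¹) * ∫⁻ x in {x : E3 | R * L < ‖x‖}, F x := by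
  have hS : MeasurableSet {x : E3 | R * L < ‖x‖} :=
    measurableSet_lt measurable_const continuous_norm.measurable
  have hS' : MeasurableSet {y : E3 | L < ‖y‖} :=
    measurableSet_lt measurable_const continuous_norm.measurable
  have hind : (fun y : E3 => ({x : E3 | R * L < ‖x‖}.indicator F) (R • y)) =
      {y : E3 | L < ‖y‖}.indicator (fun y => F (R • y)) := by
    funext y
    by_cases hy : L < ‖y‖
    · have hx : R • y ∈ {x : E3 | R * L < ‖x‖} := by
        rw [← smul_setOf_lt_norm hR]; exact Set.smul_mem_smul_set hy
      rw [indicator_of_mem hx, indicator_of_mem (show y ∈ {y : E3 | L < ‖y‖} from hy)]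
    · have hx : R • y ∉ {x : E3 | R * L < ‖x‖} := by
        rw [← smul_setOf_lt_norm hR, Set.smul_mem_smul_set_iff₀ hR.ne']; exact hy
      rw [indicator_of_notMem hx, indicator_of_notMem (show y ∉ {y : E3 | L < ‖y‖} from hy)]
  rw [← lintegral_indicator hS', ← hind, lintegral_comp_smul_E3 hR, lintegral_indicator hS]

/-- **The rescaled absolute tail against the physical one** (p.24, the «scaled forms» behind
(3.75)–(3.78)): for `R, L > 0`,
`∫⁻_{|y|>L} |Q_R| |V_R| |y|⁻² dy = R · ∫⁻_{|x|>RL} |𝒬| |v| |x|⁻² dx`. [cite: Wu2026, (3.75)–(3.78) p.24] -/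
theorem lintegral_tail_blowDown {R : ℝ} (hR : 0 < R) (L : ℝ) (v : E3 → E3)
    (q : E3 → ℝ) :
    ∫⁻ y in {y : E3 | L < ‖y‖}, ENNReal.ofReal
        (|bern (blowDown R v) (blowDownP R q) y| * ‖blowDown R v y‖ * ‖y‖ ^ (-(2 : ℝ))) =
      ENNReal.ofReal R * ∫⁻ x in {x : E3 | R * L < ‖x‖},
        ENNReal.ofReal (|bern v q x| * ‖v x‖ * ‖x‖ ^ (-(2 : ℝ))) := by
  have hcongr : ∫⁻ y in {y : E3 | L < ‖y‖}, ENNReal.ofReal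
        (|bern (blowDown R v) (blowDownP R q) y| * ‖blowDown R v y‖ * ‖y‖ ^ (-(2 : ℝ))) =
      ∫⁻ y in {y : E3 | L < ‖y‖}, (fun x => ENNReal.ofReal (R ^ 4) *
        ENNReal.ofReal (|bern v q x| * ‖v x‖ * ‖x‖ ^ (-(2 : ℝ)))) (R • y) := by
    refine setLIntegral_congr_fun (measurableSet_lt measurable_const continuous_norm.measurable)
      (fun y _ => ?_)
    rw [abs_bern_mul_norm_blowDown hR v q y, ENNReal.ofReal_mul (pow_nonneg hR.le 4)]
  rw [hcongr, setLIntegral_exterior_comp_smul hR L (fun x => ENNReal.ofReal (R ^ 4) *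
        ENNReal.ofReal (|bern v q x| * ‖v x‖ * ‖x‖ ^ (-(2 : ℝ)))),
    lintegral_const_mul' _ _ ENNReal.ofReal_ne_top,
    ← mul_assoc, ← ENNReal.ofReal_mul (inv_nonneg.2 (pow_nonneg hR.le 3))]
  congr 2
  field_simp

end Summit.NavierStokesRegularity.NavierStokesRegularity.Theorems.Wu2026Salvage

end

-- WHAT THIS IS NOT: not a claim about NS regularity or blow-up; not a claim about any author beyond the typed locator.
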